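import Summits.ResolutionOfSingularities.ResolutionOfSingularities.Theorems.SplitCutClasses
import HarnessLib

/-!
# SplitCutCells — decomp-res node «SplitCut» (lens-2 g17)

Content VERBATIM from the decomp-res lens-2 g17 node `HOME/decomp-res-lens-2/g17/SplitCut.lean` (pin 301f7a3a, 2 469
l; parts in `g17/parts/`, SHA256SUMS verified by the critic;
HOME = run/shared/lean/pub/decomp-res; CRITIC-LEDGER row 146 (claim DECIDED-MOD-PORT(M+) +1 under row 140's window
(ii)); landing orders INBOX :365: land AFTER the PurityCut
chain with ALL restated sections (§R16, §R, §G, §P, §H — l. 244–2018: the lens's verbatim-in-body copies of lens-2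
g14 `PinchCut`, g15 `JetCut` rev 5 and g16 `PurityCut` rev 1)
DELETED and the landed modules imported instead (namespaces `…Theorems.PinchCut`, `…Theorems.JetCut` (+ `Vast`),
`…Theorems.PurityCut` (+ `Leaf`, `Grand`) opened; same short
names, byte-identical bodies — never two copies).  Namespace `…Theorems.SplitCut` (the lens's `Theses.SplitCut` is
gate-reserved), sub-namespace `Split` as in the lens;
file split only (tree files ≤ 400 lines): sections, variables and every declaration exactly as in the lens; the
node's global dupNamespace-linter line dropped.  Node files,
in import order: `SplitCutKernels` (§S1) · `SplitCutClasses` (§S2 + the cone-free head of §T) · `SplitCutCells`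
(§T2–§T4 cone-free: the aside home) · the wiring
`MaxContactCutSplitCut` (§T BY NAME on the host route, in the Theses cone).  All `--supports
stmt-ResolutionOfSingularities-29273` (`MaxContactCut.RungOne`); nothing closes
29273 — decided halves carry their engines as hypotheses; exactly ONE located-residual aside on the lens-2 column
(`Split.SplitSpecialRung`, home `SplitCutCells`) SUPERSEDES
g16's `Grand.GrandSpecialRung`, re-located EXACTLY modulo the split decided half (`grandSpecialRung_iff_splitSpecialRung`).

§T2–§T4 cone-free part — `namespace Split`: the graded statements `SeqSGen` / `SeqSSpec` / `SGenRungAt`, the rungs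
**`SplitGenericRung`** (DECIDED half, engines as hypotheses: `splitGenericRung_of_engines`) / **`SplitSpecialRung`**
(THE LOCATED RESIDUAL of the node — the ONE aside on the lens-2 column, SUPERSEDING g16's `Grand.GrandSpecialRung`),
their `…_iff` with the §G `Leaf` schema, `grandSpecialRung_of_splitSpecialRung` and the other hypothesis-free links
— statement-level + pure logic; this module is the cone-free aside home.  The cut BY NAME on the route
(`Split.rungOne_iff`, `Split.closes`, `closes_of_engines`, `grandSpecialRung_iff_splitSpecialRung`, vast / leaf /
pinch iffs, `grand_closes_of_split`) is in `MaxContactCutSplitCut`.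

(Sources: Hironaka1964 Ch. III; CossartJannsenSaito2020 Ch. 2, Ch. 8–9; CossartPiltant2008 Prop. 4.2;
CossartPiltant2019 Rem. 3.2; BierstoneGrigorievMilmanWlodarczyk2011 §3.1; Moh1987; Hauser2010Kangaroo; Giraud1975;
Narasimhan1983.)
-/

open CategoryTheory AlgebraicGeometry TopologicalSpace IsLocalRing
open Literature.AlgebraicGeometry.Resolution
open Summit.ResolutionOfSingularities.ResolutionOfSingularities.Theorems
open Summit.ResolutionOfSingularities.ResolutionOfSingularities.Theorems.WeakOrderReduction
open Summit.ResolutionOfSingularities.ResolutionOfSingularities.Theorems.DeltaFaceCutClasses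
open Summit.ResolutionOfSingularities.ResolutionOfSingularities.Theorems.RelativeDeltaCut
open Summit.ResolutionOfSingularities.ResolutionOfSingularities.Theorems.CurveLeafExit
open Summit.ResolutionOfSingularities.ResolutionOfSingularities.Theorems.PinchCut
open Summit.ResolutionOfSingularities.ResolutionOfSingularities.Theorems.JetCut
open Summit.ResolutionOfSingularities.ResolutionOfSingularities.Theorems.PurityCut

namespace Summit.ResolutionOfSingularities.ResolutionOfSingularities.Theorems.SplitCut

namespace Split

/-! ### §T2  The graded statements of the SPLIT cut (instances of §G with the split leaf) -/

/-- **`SeqSGen n`** — weak order reduction in dimension four at marking `n` for data ALL of whose top points are in the ten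
decided classes of g16 or SPLIT-CONE-CURVE points.  [DECIDED-MOD-PORT: `sGenRungAt_of_engines`.]  STATEMENT SCHEMA
(= `Leaf.SeqGen splitLeaf n`). (Sources: BierstoneGrigorievMilmanWlodarczyk2011 §3.1; CossartPiltant2008 Prop. 4.2;
Hironaka1967.) -/
def SeqSGen (n : ℕ) : Prop := Leaf.SeqGen splitLeaf n

/-- **`SeqSSpec n`** — THE LOCATED CLASS: weak order reduction at marking `n` for data having a SPLIT-SPECIAL core top point.
[UNDECIDED · IDEA-NEEDED.]  STATEMENT SCHEMA (= `Leaf.SeqSpec splitLeaf n`). (Sources: CossartPiltant2019 Rem. 3.2; Moh1987.) -/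
def SeqSSpec (n : ℕ) : Prop := Leaf.SeqSpec splitLeaf n

/-- `SGenRungAt n` — the decided rung at one marking. -/
def SGenRungAt (n : ℕ) : Prop := SeqDimFour 2 n → SeqSGen n

/-- **`SplitGenericRung`** — the DECIDED half of `RungOne` (29273) for the split leaf.  [WEAKER · DECIDED-MOD-PORT(M+):
`splitGenericRung_of_engines`.]  STATEMENT (decided piece). (Sources: CossartPiltant2008 Prop. 4.2; Hironaka1967;
CossartJannsenSaito2020.) -/
def SplitGenericRung : Prop := E 2 → ∀ n : ℕ, 1 ≤ n → SeqSGen n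

/-- **`SplitSpecialRung`** — THE LOCATED RESIDUAL of this node: `E 2 →` weak order reduction for every marking and
all data with a
split-special core top point.  [WEAKER BY LETTER than `Grand.GrandSpecialRung` · UNDECIDED · IDEA-NEEDED · cofinal ⇒ score 0.]
STATEMENT (located residual). (Sources: CossartPiltant2019 Rem. 3.2; Moh1987; Giraud1975; Narasimhan1983.) -/
def SplitSpecialRung : Prop := E 2 → ∀ n : ℕ, 1 ≤ n → SeqSSpec n

/-- `splitGenericRung_iff`: Auxiliary step of this node's calculus, VERBATIM from the lens file (see the module
docstring); the statement is its type. [folklore] -/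
theorem splitGenericRung_iff : SplitGenericRung ↔ Leaf.GenericRung splitLeaf := Iff.rfl

/-- `splitSpecialRung_iff`: Auxiliary step of this node's calculus, VERBATIM from the lens file (see the module
docstring); the statement is its type. [folklore] -/
theorem splitSpecialRung_iff : SplitSpecialRung ↔ Leaf.SpecialRung splitLeaf := Iff.rfl

section Kernels

variable {n : ℕ}

/-! ### §T3  Kernels of the SPLIT cut (instantiated from §G; 0 sorry) -/

/-- **EXACT at each marking**: `SeqDimFour 1 n ⟺ SeqSGen n ∧ SeqSSpec n`. [folklore] -/
theorem seqDimFour_one_iff : SeqDimFour 1 n ↔ SeqSGen n ∧ SeqSSpec n :=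
  Leaf.seqDimFour_one_iff (L := splitLeaf)

/-- Under the engines (M) (C) (G) (S) every point of the split leaf is a curve-exit point. [folklore] -/
theorem isCurveExitPt_of_splitLeaf (hM : MonomialPinchExit) (hC : FlatConeExit) (hGE : GrandExit) (hSE : SplitConeExit)
    (hn : 2 ≤ n) ⦃Y : Scheme.{0}⦄ (hY : Scheme.IsRegular Y) ⦃I : Y.IdealSheafData⦄ ⦃y : Y⦄ (h : splitLeaf I n y) :
    IsCurveExitPt I n y := by
  rcases h with h | h | h | h
  · exact isCurveExitPt_of_isPinchCurvePt hM hY hn h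
  · exact isCurveExitPt_of_isConeCurvePt hC hY hn h
  · exact isCurveExitPt_of_isGrandCurvePt hGE hY hn h
  · exact isCurveExitPt_of_isSplitConeCurvePt hSE hY hn h

/-- **THE ENGINES AT WORK**: the five tree engines, g14's (M) and (C), g16's (G), the NEW engine (S) and g12's port give
`SGenRungAt n` for `n ≥ 2`. [folklore] -/
theorem sGenRungAt_of_engines (hV : VeryNearCutClasses.VeryNearExit) (hD : DeltaPackageExit)
    (hU : UniformCurvePackageExit) (hR : RelCurvePackageExit) (hN : NormalConeJumpExit)
    (hM : MonomialPinchExit) (hC : FlatConeExit) (hGE : GrandExit) (hSE : SplitConeExit) (hP : CurvePackagePort n)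
    (hn : 2 ≤ n) : SGenRungAt n :=
  Leaf.genRungAt_of_port (L := splitLeaf) hV hD hU hR hN (isCurveExitPt_of_splitLeaf hM hC hGE hSE hn) hP hn

/-- **`SplitGenericRung` is DECIDED modulo the typed pieces**: engines (as hypotheses), g12's port at every marking `≥ 2`, the
order-one contact port. [folklore] -/
theorem splitGenericRung_of_engines (hV : VeryNearCutClasses.VeryNearExit) (hD : DeltaPackageExit)
    (hU : UniformCurvePackageExit) (hR : RelCurvePackageExit) (hN : NormalConeJumpExit)
    (hM : MonomialPinchExit) (hC : FlatConeExit) (hGE : GrandExit) (hSE : SplitConeExit)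
    (hP : ∀ n : ℕ, 2 ≤ n → CurvePackagePort n) (h1 : FaceFormCutClasses.OrderOneContact) : SplitGenericRung :=
  Leaf.genericRung_of_port (L := splitLeaf) hV hD hU hR hN
    (fun _ hn => isCurveExitPt_of_splitLeaf hM hC hGE hSE hn) hP h1

/-! ### §T4  EXACT RE-LOCATIONS (the residual shrinks; equivalent modulo the split decided half) -/

/-- **REFINEMENT EDGE (hypothesis-free)**: g16's residual implies g17's — `Grand.GrandSpecialRung → SplitSpecialRung` (WEAKER BY
LETTER). [folklore] -/
theorem splitSpecialRung_of_grandSpecialRung (h : Grand.GrandSpecialRung) : SplitSpecialRung :=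
  Leaf.specialRung_mono grandLeaf_le_splitLeaf (Grand.grandSpecialRung_iff.mp h)

/-- The split decided half contains g16's: `SplitGenericRung → Grand.GrandGenericRung`. [folklore] -/
theorem grandGenericRung_of_splitGenericRung (h : SplitGenericRung) : Grand.GrandGenericRung :=
  Grand.grandGenericRung_iff.mpr (Leaf.genericRung_anti grandLeaf_le_splitLeaf h)

end Kernels

end Split

end Summit.ResolutionOfSingularities.ResolutionOfSingularities.Theorems.SplitCut
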